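import Literature.IUT.LogVolume.PilotSlotResidueBounds
import HarnessLib

/-!
# The (Ind1) slot residue depends only on the primes under the bad places

PROOF-ONLY sequel to `PilotSlotResidue.lean` / `PilotSlotResidueBounds.lean` (abc-iut cell, campaign-S seat
abc-iut-S8). Dupuy–Hilado, arXiv:2004.13228 [DupuyHilado2025]: §3.3 (`P_{Θ,j}` is supported on the chosen bad
places `S`), §3.6 (`V(F)_p`, weights), Def. 3.6.3 (`ln ν̄_𝕃 = Σ_p ln ν̄_{𝕃_p}` over a finite set of primes
containing the support — the cell's `TODO(general form)` convention: abc-iut-S2's `supportPrimes`, c312-3's `DHData.T`);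
S. Mochizuki, *IUT IV* [Mochizuki2012], Thm. 1.10 Step (vi) p. 29 (at `v_ℚ ∉ V^dst` the theta gain is `0`).

WHAT IS PROVED: the residue `PilotData.slotResidue X T` has NO contribution from an index `p` over which no place of
`S` lies (`θ_j ≡ 0` on `V(F)_p` there: `inner_defect_sum_eq_zero_of_no_bad`), hence
* `slotResidue_eq_filter` — `slotResidue X T = slotResidue X {p ∈ T | some v ∈ S lies over p}`;
* `slotResidue_mono` — monotone in `T`;
* `slotResidue_eq_of_support` — for any two finite sets of PRIMES `T, T'` both containing the residue characteristics
  of `S`, `slotResidue X T = slotResidue X T'`: the residue is CANONICAL (independent of the bookkeeping set of primes,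
  e.g. abc-iut-S2's `supportPrimes ⊇ char(S)` versus `char(S)` itself, `slotResidue_eq_image_residueChar`).
So the quantity that child (ii′) of stmt-ABC-19678 must absorb (summit-side `LDHSlotResidue.lean`) is a function of the
pilot data `(F_mod, j_E, S, l)` alone. Nothing here takes a side on [IUTchIII] Cor. 3.12; typed ≠ endorsed.
-/

noncomputable section

namespace Literature.IUT.LogVolume

open NumberField IsDedekindDomain Finset

namespace PilotData

variable {F : Type*} [Field F] [NumberField F] (X : PilotData F)

/-- Off `S` the coefficient of `P_{Θ,j}` is `0`. [cite: DupuyHilado2025, §3.3] -/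
private theorem thetaPilot_apply_of_not_mem' (i : Fin X.lstar) {v : HeightOneSpectrum (𝓞 F)} (hv : v ∉ X.S) :
    X.thetaPilot i v = 0 := by
  classical
  simp only [thetaPilot, FinDivisor.of, Finsupp.finsetSum_apply, Finsupp.single_apply,
    Finset.sum_ite_eq', if_neg hv]

/-- Off `S` the gain vanishes: `θ_j(v) = 0` for `v ∉ S`. [cite: DupuyHilado2025, §3.3] -/
theorem slotValue_eq_zero_of_not_mem (i : Fin X.lstar) {v : HeightOneSpectrum (𝓞 F)} (hv : v ∉ X.S) :
    X.slotValue i v = 0 := by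
  rw [slotValue, X.thetaPilot_apply_of_not_mem' i hv, zero_mul, zero_div]

/-- **No bad place over `p` ⇒ no residue at `p`**: if no place of `S` lies in `V(F)_p`, the inner collection sum of
the residue at `(p, j)` vanishes (every slot value is `0`, so last slot = least slot). This is the situation of
[IUTchIV] Thm. 1.10 Step (vi) (`v_ℚ ∉ V^dst`). [cite: Mochizuki2012, IUTchIV Thm. 1.10 Step (vi) p. 29] -/
theorem inner_defect_sum_eq_zero_of_no_bad (p : ℕ) (hp : ∀ v ∈ placesOver F p, v ∉ X.S) (i : Fin X.lstar) :
    ∑ e : Fin ((i : ℕ) + 1 + 1) → placesOver F p,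
        (X.slotValue i (e (Fin.last _)).1
          - Finset.univ.inf' Finset.univ_nonempty (fun k => X.slotValue i (e k).1)) *
          ∏ k, weight F (e k).1 = 0 := by
  refine Finset.sum_eq_zero fun e _ => ?_
  have h0 : ∀ k : Fin ((i : ℕ) + 1 + 1), X.slotValue i (e k).1 = 0 :=
    fun k => X.slotValue_eq_zero_of_not_mem i (hp _ (e k).2)
  simp only [h0, Finset.inf'_const, sub_self, zero_mul]

open scoped Classical in
/-- **The residue lives on the primes under `S`**: `slotResidue X T = slotResidue X {p ∈ T | ∃ v ∈ S, v ∈ V(F)_p}`.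
[cite: DupuyHilado2025, §3.3, Def. 3.6.3] -/
theorem slotResidue_eq_filter (T : Finset ℕ) :
    X.slotResidue T = X.slotResidue (T.filter fun p => ∃ v ∈ X.S, v ∈ placesOver F p) := by
  rw [slotResidue_eq_sum, slotResidue_eq_sum,
    ← Finset.sum_filter_add_sum_filter_not T (fun p => ∃ v ∈ X.S, v ∈ placesOver F p)]
  conv_rhs => rw [← add_zero (∑ p ∈ T.filter (fun p => ∃ v ∈ X.S, v ∈ placesOver F p), _)]
  congr 1
  refine Finset.sum_eq_zero fun p hp => ?_
  rw [Finset.mem_filter] at hp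
  have hno : ∀ v ∈ placesOver F p, v ∉ X.S := fun v hv hvS => hp.2 ⟨v, hvS, hv⟩
  rw [Finset.sum_eq_zero (fun i _ => X.inner_defect_sum_eq_zero_of_no_bad p hno i), mul_zero]

/-- **Monotonicity in the index set**: `T ⊆ T' ⇒ slotResidue X T ≤ slotResidue X T'` (every `p`-term is
nonnegative). [cite: DupuyHilado2025, §4.7] -/
theorem slotResidue_mono {T T' : Finset ℕ} (h : T ⊆ T') : X.slotResidue T ≤ X.slotResidue T' := by
  rw [slotResidue_eq_sum, slotResidue_eq_sum]
  refine Finset.sum_le_sum_of_subset_of_nonneg h fun p _ _ => ?_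
  exact mul_nonneg (by positivity) (Finset.sum_nonneg fun i _ => X.inner_defect_sum_nonneg p i)

open scoped Classical in
/-- For a finite set of PRIMES `A` and any `B` containing the residue characteristics of `S`, the bad-supported
part of `A` lies in `B`. [cite: DupuyHilado2025, §2.5.4, §3.6] -/
private theorem filter_bad_subset {A B : Finset ℕ} (hA : ∀ p ∈ A, p.Prime)
    (hB : ∀ v ∈ X.S, residueChar F v ∈ B) :
    A.filter (fun p => ∃ v ∈ X.S, v ∈ placesOver F p) ⊆ B := by
  intro p hp
  rw [Finset.mem_filter] at hp
  obtain ⟨hpA, v, hvS, hvp⟩ := hp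
  haveI : Fact p.Prime := ⟨hA p hpA⟩
  rw [mem_placesOver_iff_residueChar] at hvp
  rw [← hvp]
  exact hB v hvS

/-- **The residue is canonical**: for any two finite sets of primes `T, T'` that both contain the residue
characteristics of the bad places `S`, `slotResidue X T = slotResidue X T'` — e.g. abc-iut-S2's bookkeeping set
`supportPrimes(I) = primeFactors(2·|disc K|) ∪ char(S)` and `char(S)` give the same residue.
[cite: DupuyHilado2025, Def. 3.6.3] -/
theorem slotResidue_eq_of_support {T T' : Finset ℕ} (hT : ∀ p ∈ T, p.Prime) (hT' : ∀ p ∈ T', p.Prime)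
    (hS : ∀ v ∈ X.S, residueChar F v ∈ T) (hS' : ∀ v ∈ X.S, residueChar F v ∈ T') :
    X.slotResidue T = X.slotResidue T' := by
  classical
  apply le_antisymm
  · rw [X.slotResidue_eq_filter T]
    exact X.slotResidue_mono (X.filter_bad_subset hT hS')
  · rw [X.slotResidue_eq_filter T']
    exact X.slotResidue_mono (X.filter_bad_subset hT' hS)

/-- **Canonical form**: for any finite set of primes `T ⊇ char(S)`, `slotResidue X T = slotResidue X (char(S))`
with `char(S) = S.image residueChar` the set of primes under the bad places. [cite: DupuyHilado2025, Def. 3.6.3] -/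
theorem slotResidue_eq_image_residueChar {T : Finset ℕ} (hT : ∀ p ∈ T, p.Prime)
    (hS : ∀ v ∈ X.S, residueChar F v ∈ T) :
    X.slotResidue T = X.slotResidue (X.S.image (residueChar F)) := by
  classical
  refine X.slotResidue_eq_of_support hT (fun p hp => ?_) hS (fun v hv => Finset.mem_image_of_mem _ hv)
  obtain ⟨v, _, rfl⟩ := Finset.mem_image.mp hp
  exact residueChar_prime F v

end PilotData

end Literature.IUT.LogVolume

end
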